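import Literature.Topology.FourManifolds.SegmentConjPrelim
import Literature.Topology.FourManifolds.KnotFamilyAmbientIsotopy
import Literature.Topology.FourManifolds.GluckTwistTransport
import HarnessLib

/-!
# The segment conjugation lemma: exchanging the host of a tiny inserted unit

Topic `Literature/Topology/FourManifolds` (trunk T-4MAN). Fact seat
`provefact-Literature.Topology.FourManifolds.Knot.IsConnectedSum.isIsotopic` (Schubert's theorem),
geometric heart for rail knots. **Setting** (`SegmentConj.SegData`): an ambient isotopy `Ψ` of `𝕊³`
whose end stage `Ψ₁` carries a chart segment affinely onto a chart segment,
`Ψ₁ (ψ⁻¹ (o + ρ d)) = ψ⁻¹ (o' + ρ d')` for `ρ ∈ [ρlo, ρhi] ∋ 0`. Read in the chart, `Ψ₁` is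
`Φ = chartConj Ψ` with invertible derivative `L = DΦ(o)` (`SegmentConjPrelim.lean`), `L d = d'`, and
`P = o + L⁻¹ (Φ - o')` is the identity on the segment with `DP(o) = id`.

**The lemma** (`SegData.isIsotopic_insert`). Let `I₀` be a simple regular loop (piece function on
`[a, a + 1)`) with a window `W = [w₁, w₂]` (inside the seam margin) such that: on the collars
`[w₁, c₁] ∪ [c₂, w₂]` it runs on the segment (`I₀ s = ψ⁻¹ (o + ρ d)`, `ρ ∈ [ρ₁, ρ₂]`); on `W` every
point is on that part of the segment or within `R₀` of `o` (**the unit**); off the closed window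
every point is on the segment *outside* the clock range `[ρ₁, ρ₂]`, or is carried by `Ψ₁` to a
point at chart distance `≥ R₁` from `o'` (or to the north pole). If the clock range is within the
near-identity radius and the unit radius `R₀` is small (`SegData.Small`), then the knot of `I₀` is
isotopic to the knot `K_out` which is `Ψ₁ ∘ (knot of I₀)` off `W` and `ψ⁻¹ (o' + L (ψ I₀ - o))` on
`W` — **the unit re-inserted at `o'` by the linear map `L`, inside the new host**. Proof: the knot of
`I₀` is isotopic to its image under `Ψ₁` (`isIsotopic_map`), and the latter is modified on `W` by the
family `u ↦ ψ⁻¹ (A (P_{1-u} (ψ I₀)))`, `A = o' + L (· - o)`, `P_t` the straight-line stages of `P`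
(`Knot.IsModification`: on the collars all stages agree with `Ψ₁ ∘ I₀` because `P = id` on the
segment, `L d = d'` and the segment hypothesis; injectivity and regularity on `W` from the
near-identity estimates; disjointness from the rest by clock values and distances). The thresholds
exist (`SegData.exists_small`).

Everything is proved; no named facts are introduced.

## References

* M. W. Hirsch, *Differential Topology*, GTM 33, Springer (1976), Ch. 8 §1, Thm. 1.3; §3, proof of
  Thm. 3.1 (isotopy of embeddings of discs through their linearisations). [HirschDT1976]
-/

open scoped Manifold ContDiff Topology Real
open Function Set Metric Filter

noncomputable section

namespace Literature.Topology.FourManifolds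

/-- Local notation: `𝔼 n` is the model Euclidean space `EuclideanSpace ℝ (Fin n)`. -/
local notation "𝔼 " n:arg => EuclideanSpace ℝ (Fin n)

/-- Local notation: `𝕊 n` is the unit sphere in `EuclideanSpace ℝ (Fin (n + 1))`. -/
local notation "𝕊 " n:arg => (Metric.sphere (0 : EuclideanSpace ℝ (Fin (n + 1))) 1)

attribute [local instance] fact_finrank_euclideanSpace_succ

open KnotsInBall BandData

namespace SegmentConj

/-! ### The segment data -/

/-- **Segment data**: an ambient isotopy of `𝕊³` whose end stage carries the chart segment
`o + [ρlo, ρhi] d` affinely onto `o' + [ρlo, ρhi] d'` (`ρlo < 0 < ρhi`, `d ≠ 0`). [folklore] -/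
structure SegData where
  /-- The ambient isotopy. -/
  Ψ : AmbientIsotopy (𝓡 3) (𝕊 3)
  /-- The centre of the first segment (chart coordinates). -/
  o : 𝔼 3
  /-- The centre of the second segment. -/
  o' : 𝔼 3
  /-- The direction of the first segment. -/
  d : 𝔼 3
  /-- The direction of the second segment. -/
  d' : 𝔼 3
  /-- The clock range. -/
  ρlo : ℝ
  /-- The clock range. -/
  ρhi : ℝ
  d_ne : d ≠ 0
  ρlo_neg : ρlo < 0
  ρhi_pos : 0 < ρhi
  seg : ∀ ρ ∈ Icc ρlo ρhi, stageOne Ψ (psiN.symm (o + ρ • d)) = psiN.symm (o' + ρ • d')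

namespace SegData

variable (D : SegData)

/-- The end stage carries `ψ⁻¹ o` to `ψ⁻¹ o'`. [folklore] -/
theorem stageOne_o : stageOne D.Ψ (psiN.symm D.o) = psiN.symm D.o' := by
  simpa using D.seg 0 ⟨D.ρlo_neg.le, D.ρhi_pos.le⟩

/-- `o` is a good point: `Ψ₁ (ψ⁻¹ o)` is not the north pole. [folklore] -/
theorem good : stageOne D.Ψ (psiN.symm D.o) ≠ northPole := by
  rw [D.stageOne_o]; exact psiN_symm_ne_northPole _

/-- Segment points are good. [folklore] -/
theorem good_seg {ρ : ℝ} (hρ : ρ ∈ Icc D.ρlo D.ρhi) : stageOne D.Ψ (psiN.symm (D.o + ρ • D.d)) ≠ northPole := by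
  rw [D.seg ρ hρ]; exact psiN_symm_ne_northPole _

/-- **The chart conjugate on the segment**: `Φ (o + ρ d) = o' + ρ d'`. [folklore] -/
theorem chartConj_seg {ρ : ℝ} (hρ : ρ ∈ Icc D.ρlo D.ρhi) : chartConj D.Ψ (D.o + ρ • D.d) = D.o' + ρ • D.d' := by
  rw [chartConj, D.seg ρ hρ, psiN_apply_psiN_symm]

/-- `Φ o = o'`. [folklore] -/
theorem chartConj_o : chartConj D.Ψ D.o = D.o' := by
  simpa using D.chartConj_seg (ρ := 0) ⟨D.ρlo_neg.le, D.ρhi_pos.le⟩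

/-- **The linearisation** `L = DΦ(o)`, a continuous linear equivalence. [folklore] -/
def L : (𝔼 3) ≃L[ℝ] 𝔼 3 := linConj D.Ψ D.good

/-- `L` as a map is `fderiv Φ o`. [folklore] -/
theorem coe_L : ((D.L : (𝔼 3) ≃L[ℝ] 𝔼 3) : (𝔼 3) →L[ℝ] 𝔼 3) = fderiv ℝ (chartConj D.Ψ) D.o := rfl

/-- **`L d = d'`** (differentiate the segment relation). [folklore] -/
theorem L_d : D.L D.d = D.d' := by
  have h := fderiv_apply_eq_of_segment (Φ := chartConj D.Ψ) (o := D.o) (o' := D.o') (d := D.d) (d' := D.d')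
    (ρ₀ := min (-D.ρlo) D.ρhi) (lt_min (by linarith [D.ρlo_neg]) D.ρhi_pos)
    (fun ρ hρ ↦ D.chartConj_seg ⟨by linarith [hρ.1, min_le_left (-D.ρlo) D.ρhi], by linarith [hρ.2, min_le_right (-D.ρlo) D.ρhi]⟩)
    ((contDiffAt_chartConj D.Ψ D.good).differentiableAt (by simp))
  exact h

/-- `L⁻¹ d' = d`. [folklore] -/
theorem L_symm_d' : D.L.symm D.d' = D.d := by
  rw [← D.L_d, ContinuousLinearEquiv.symm_apply_apply]

/-- `d' ≠ 0`. [folklore] -/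
theorem d'_ne : D.d' ≠ 0 := by
  rw [← D.L_d]; exact D.L.map_ne_zero_iff.2 D.d_ne

/-- **The affine re-insertion map** `A y = o' + L (y - o)`. [folklore] -/
def A (y : 𝔼 3) : 𝔼 3 := D.o' + D.L (y - D.o)

/-- **The normalised conjugate** `P y = o + L⁻¹ (Φ y - o')`, with `A ∘ P = Φ`. [folklore] -/
def P (y : 𝔼 3) : 𝔼 3 := D.o + D.L.symm (chartConj D.Ψ y - D.o')

/-- `A (P y) = Φ y`. [folklore] -/
theorem A_P (y : 𝔼 3) : D.A (D.P y) = chartConj D.Ψ y := by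
  simp [A, P]

/-- The affine map is injective. [folklore] -/
theorem A_injective : Injective D.A := fun y y' h ↦ by
  have : D.L (y - D.o) = D.L (y' - D.o) := add_left_cancel h
  exact sub_left_injective (D.L.injective this)

/-- `A o = o'`. [folklore] -/
@[simp] theorem A_o : D.A D.o = D.o' := by simp [A]

/-- Distances under the affine map: `‖A y - o'‖ ≤ ‖L‖ ‖y - o‖`. [folklore] -/
theorem norm_A_sub_le (y : 𝔼 3) : ‖D.A y - D.o'‖ ≤ ‖((D.L : (𝔼 3) ≃L[ℝ] 𝔼 3) : (𝔼 3) →L[ℝ] 𝔼 3)‖ * ‖y - D.o‖ := by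
  rw [A, add_sub_cancel_left]; exact ContinuousLinearMap.le_opNorm _ _

/-- `A` on the segment: `A (o + ρ d) = o' + ρ d'`. [folklore] -/
theorem A_seg (ρ : ℝ) : D.A (D.o + ρ • D.d) = D.o' + ρ • D.d' := by
  simp [A, D.L_d]

/-- The affine map is `C^∞`. [folklore] -/
theorem contDiff_A : ContDiff ℝ ∞ D.A :=
  contDiff_const.add ((((D.L : (𝔼 3) ≃L[ℝ] 𝔼 3) : (𝔼 3) →L[ℝ] 𝔼 3).contDiff).comp (contDiff_id.sub contDiff_const))

/-- The derivative of the affine map. [folklore] -/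
theorem hasFDerivAt_A (y : 𝔼 3) : HasFDerivAt D.A ((D.L : (𝔼 3) ≃L[ℝ] 𝔼 3) : (𝔼 3) →L[ℝ] 𝔼 3) y := by
  have e : D.A = fun y ↦ (D.o' - D.L D.o) + ((D.L : (𝔼 3) ≃L[ℝ] 𝔼 3) : (𝔼 3) →L[ℝ] 𝔼 3) y := by
    funext y; simp only [A, map_sub, ContinuousLinearEquiv.coe_coe]; abel
  rw [e]; exact (((D.L : (𝔼 3) ≃L[ℝ] 𝔼 3) : (𝔼 3) →L[ℝ] 𝔼 3).hasFDerivAt).const_add _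

/-- **The good set** `U = {y | Ψ₁ (ψ⁻¹ y) ≠ northPole}`, open, containing `o`. [folklore] -/
def U : Set (𝔼 3) := {y : 𝔼 3 | stageOne D.Ψ (psiN.symm y) ≠ northPole}

/-- The good set is open. [folklore] -/
theorem isOpen_U : IsOpen D.U := isOpen_setOf_stageOne_ne D.Ψ

/-- `o ∈ U`. [folklore] -/
theorem o_mem_U : D.o ∈ D.U := D.good

/-- **`P` is `C^∞` on the good set.** [folklore] -/
theorem contDiffOn_P : ContDiffOn ℝ ∞ D.P D.U := fun y hy ↦
  (contDiffAt_const.add (((D.L.symm : (𝔼 3) ≃L[ℝ] 𝔼 3) : (𝔼 3) →L[ℝ] 𝔼 3).contDiff.contDiffAt.comp y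
    ((contDiffAt_chartConj D.Ψ hy).sub contDiffAt_const))).contDiffWithinAt

/-- `P` is `C^∞` at good points. [folklore] -/
theorem contDiffAt_P {y : 𝔼 3} (hy : y ∈ D.U) : ContDiffAt ℝ ∞ D.P y :=
  D.contDiffOn_P.contDiffAt (D.isOpen_U.mem_nhds hy)

/-- **`P` is the identity on the segment.** [folklore] -/
theorem P_seg {ρ : ℝ} (hρ : ρ ∈ Icc D.ρlo D.ρhi) : D.P (D.o + ρ • D.d) = D.o + ρ • D.d := by
  rw [P, D.chartConj_seg hρ, add_sub_cancel_left, map_smul, D.L_symm_d']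

/-- `P o = o`. [folklore] -/
theorem P_o : D.P D.o = D.o := by
  simpa using D.P_seg (ρ := 0) ⟨D.ρlo_neg.le, D.ρhi_pos.le⟩

/-- **`DP(o) = id`.** [folklore] -/
theorem fderiv_P_o : fderiv ℝ D.P D.o = ContinuousLinearMap.id ℝ (𝔼 3) := by
  have hΦ : HasFDerivAt (chartConj D.Ψ) (((D.L : (𝔼 3) ≃L[ℝ] 𝔼 3) : (𝔼 3) →L[ℝ] 𝔼 3)) D.o := by
    rw [D.coe_L]; exact ((contDiffAt_chartConj D.Ψ D.good).differentiableAt (by simp)).hasFDerivAt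
  have h : HasFDerivAt D.P ((((D.L.symm : (𝔼 3) ≃L[ℝ] 𝔼 3) : (𝔼 3) →L[ℝ] 𝔼 3)).comp
      ((D.L : (𝔼 3) ≃L[ℝ] 𝔼 3) : (𝔼 3) →L[ℝ] 𝔼 3)) D.o := by
    have h1 := (((D.L.symm : (𝔼 3) ≃L[ℝ] 𝔼 3) : (𝔼 3) →L[ℝ] 𝔼 3).hasFDerivAt).comp D.o (hΦ.sub_const D.o')
    exact (h1.const_add D.o).congr_of_eventuallyEq (Eventually.of_forall fun y ↦ by simp [P])
  rw [h.fderiv]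
  ext v
  simp

/-! ### Smallness thresholds -/

/-- **Smallness**: the window clock range `[ρ₁, ρ₂]`, the unit radius `R₀` and the far radius `R₁`
against the near-identity radius `r_c` of `P`. [folklore] -/
structure Small (ρ₁ ρ₂ R₀ R₁ rc : ℝ) : Prop where
  rc_pos : 0 < rc
  ball_subset : closedBall D.o rc ⊆ D.U
  fderiv_le : ∀ y ∈ closedBall D.o rc, ‖fderiv ℝ D.P y - ContinuousLinearMap.id ℝ (𝔼 3)‖ ≤ 1 / 2
  ρ₁_le : D.ρlo ≤ ρ₁
  ρ₁_neg : ρ₁ < 0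
  ρ₂_pos : 0 < ρ₂
  ρ₂_le : ρ₂ ≤ D.ρhi
  seg_ball : ∀ ρ ∈ Icc ρ₁ ρ₂, ‖ρ • D.d‖ ≤ rc
  R₀_pos : 0 < R₀
  R₀_le : 3 / 2 * R₀ ≤ rc
  unit_seg : ‖((D.L : (𝔼 3) ≃L[ℝ] 𝔼 3) : (𝔼 3) →L[ℝ] 𝔼 3)‖ * (3 / 2 * R₀) < min (-ρ₁) ρ₂ * ‖D.d'‖
  R₁_pos : 0 < R₁
  seg_far : ∀ ρ ∈ Icc ρ₁ ρ₂, ‖ρ • D.d'‖ < R₁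
  unit_far : ‖((D.L : (𝔼 3) ≃L[ℝ] 𝔼 3) : (𝔼 3) →L[ℝ] 𝔼 3)‖ * (3 / 2 * R₀) < R₁

/-- **Existence of thresholds**: for every far radius `R₁ > 0` there is `ρmax > 0` such that every
clock range `[ρ₁, ρ₂] ∋ 0` inside `[-ρmax, ρmax]` admits a unit radius `R₀ > 0` (and a near-identity
radius) satisfying the smallness conditions. [folklore] -/
theorem exists_small {R₁ : ℝ} (hR₁ : 0 < R₁) :
    ∃ ρmax > 0, ∀ ρ₁ ρ₂, -ρmax ≤ ρ₁ → ρ₁ < 0 → 0 < ρ₂ → ρ₂ ≤ ρmax → ∃ R₀ rc, D.Small ρ₁ ρ₂ R₀ R₁ rc := by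
  obtain ⟨rc, hrc, hsub, hbd⟩ := exists_nearId_ball D.isOpen_U D.o_mem_U D.contDiffOn_P D.fderiv_P_o
  have hd : 0 < ‖D.d‖ := norm_pos_iff.2 D.d_ne
  have hd' : 0 < ‖D.d'‖ := norm_pos_iff.2 D.d'_ne
  set NL := ‖((D.L : (𝔼 3) ≃L[ℝ] 𝔼 3) : (𝔼 3) →L[ℝ] 𝔼 3)‖
  have hNL : 0 ≤ NL := norm_nonneg _
  set ρmax := min (min (-D.ρlo) D.ρhi) (min (rc / ‖D.d‖) (R₁ / (2 * ‖D.d'‖))) with hρmax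
  have hρmax_pos : 0 < ρmax := lt_min (lt_min (by linarith [D.ρlo_neg]) D.ρhi_pos) (lt_min (by positivity) (by positivity))
  have h1 : ρmax ≤ -D.ρlo := (min_le_left _ _).trans (min_le_left _ _)
  have h2 : ρmax ≤ D.ρhi := (min_le_left _ _).trans (min_le_right _ _)
  have h3 : ρmax ≤ rc / ‖D.d‖ := (min_le_right _ _).trans (min_le_left _ _)
  have h4 : ρmax ≤ R₁ / (2 * ‖D.d'‖) := (min_le_right _ _).trans (min_le_right _ _)
  refine ⟨ρmax, hρmax_pos, fun ρ₁ ρ₂ hρ₁ hρ₁0 hρ₂0 hρ₂ ↦ ?_⟩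
  set m := min (-ρ₁) ρ₂
  have hm : 0 < m := lt_min (by linarith) hρ₂0
  set R₀ := min (rc / 2) (min (m * ‖D.d'‖ / (2 * (NL + 1))) (R₁ / (2 * (NL + 1)))) with hR₀
  have hR₀pos : 0 < R₀ := lt_min (by positivity) (lt_min (by positivity) (by positivity))
  have e1 : R₀ ≤ rc / 2 := min_le_left _ _
  have e2 : R₀ ≤ m * ‖D.d'‖ / (2 * (NL + 1)) := (min_le_right _ _).trans (min_le_left _ _)
  have e3 : R₀ ≤ R₁ / (2 * (NL + 1)) := (min_le_right _ _).trans (min_le_right _ _)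
  have abs_le_of : ∀ ρ ∈ Icc ρ₁ ρ₂, |ρ| ≤ ρmax := fun ρ hρ ↦ abs_le.2 ⟨by linarith [hρ.1], by linarith [hρ.2]⟩
  refine ⟨R₀, rc, ⟨hrc, hsub, hbd, by linarith, hρ₁0, hρ₂0, by linarith, fun ρ hρ ↦ ?_, hR₀pos, by linarith, ?_, hR₁,
    fun ρ hρ ↦ ?_, ?_⟩⟩
  · rw [norm_smul, Real.norm_eq_abs]
    have := abs_le_of ρ hρ
    rw [le_div_iff₀ hd] at h3
    nlinarith
  · rw [le_div_iff₀ (by positivity)] at e2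
    nlinarith
  · rw [norm_smul, Real.norm_eq_abs]
    have := abs_le_of ρ hρ
    rw [le_div_iff₀ (by positivity)] at h4
    nlinarith
  · rw [le_div_iff₀ (by positivity)] at e3
    nlinarith

/-! ### Loop frames -/

/-- **Loop frames** for the segment data: a simple regular loop (piece function `I₀` on
`[a, a + 1)`) with a window `[w₁, w₂]` and collars `[w₁, c₁]`, `[c₂, w₂]` on which it runs on the
segment with clock in `[ρ₁, ρ₂]`, whose window points are on that segment piece or within `R₀` of
`o`, and whose points off the closed window are segment points with clock outside `[ρ₁, ρ₂]` or are
carried by `Ψ₁` to points at chart distance `≥ R₁` from `o'` (or to the north pole). [folklore] -/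
structure Frame (ρ₁ ρ₂ R₀ R₁ : ℝ) where
  /-- The piece function. -/
  I₀ : ℝ → 𝔼 4
  /-- The base of the fundamental domain. -/
  a : ℝ
  /-- The seam margin. -/
  ε₀ : ℝ
  /-- The window and its collars. -/
  w₁ : ℝ
  c₁ : ℝ
  c₂ : ℝ
  w₂ : ℝ
  contDiff : ContDiff ℝ ∞ I₀
  isRegularLoop : IsRegularLoop (periodise a I₀)
  injOn : InjOn I₀ (Ico a (a + 1))
  ε₀_pos : 0 < ε₀
  seam : ∀ t ∈ Ioo (a - ε₀) (a + ε₀), I₀ (t + 1) = I₀ t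
  le_w₁ : a + ε₀ ≤ w₁
  w₁_lt : w₁ < c₁
  c₁_lt : c₁ < c₂
  c₂_lt : c₂ < w₂
  w₂_le : w₂ ≤ a + 1 - ε₀
  collar : ∀ s, s ∈ Icc w₁ c₁ ∪ Icc c₂ w₂ → ∃ ρ ∈ Icc ρ₁ ρ₂, I₀ s = ((psiN.symm (D.o + ρ • D.d) : 𝕊 3) : 𝔼 4)
  inner : ∀ s ∈ Icc w₁ w₂, (∃ ρ ∈ Icc ρ₁ ρ₂, I₀ s = ((psiN.symm (D.o + ρ • D.d) : 𝕊 3) : 𝔼 4)) ∨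
    ∃ y ∈ closedBall D.o R₀, I₀ s = ((psiN.symm y : 𝕊 3) : 𝔼 4)
  off : ∀ t ∈ Ico a (a + 1), t ∉ Icc w₁ w₂ →
    (∃ ρ ∈ Icc D.ρlo D.ρhi, ρ ∉ Icc ρ₁ ρ₂ ∧ I₀ t = ((psiN.symm (D.o + ρ • D.d) : 𝕊 3) : 𝔼 4)) ∨
    ∃ x : 𝕊 3, I₀ t = (x : 𝔼 4) ∧ (stageOne D.Ψ x = northPole ∨ R₁ ≤ ‖psiN (stageOne D.Ψ x) - D.o'‖)

namespace Frame

variable {D} {ρ₁ ρ₂ R₀ R₁ rc : ℝ} (Fr : D.Frame ρ₁ ρ₂ R₀ R₁)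

/-- **The base knot** of the frame. [folklore] -/
def baseKnot : Knot := Fr.isRegularLoop.toKnot (periodise_simple_iff.2 Fr.injOn)

/-- The base knot through `circlePt t` is `I₀ t` on the fundamental domain. [folklore] -/
theorem coe_baseKnot_circlePt {t : ℝ} (ht : t ∈ Ico Fr.a (Fr.a + 1)) :
    ((Fr.baseKnot (circlePt t) : 𝕊 3) : 𝔼 4) = Fr.I₀ t := by
  rw [baseKnot, Fr.isRegularLoop.coe_toKnot_circlePt, periodise_eq_self Fr.a _ ht]

/-- **The moved knot** `Ψ₁ ∘ (base knot)`. [folklore] -/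
def movedKnot : Knot := Fr.baseKnot.map (stageOne D.Ψ)

/-- The base knot is isotopic to the moved knot. [folklore] -/
theorem isIsotopic_baseKnot_movedKnot : Fr.baseKnot.IsIsotopic Fr.movedKnot :=
  SphereEmbedding.isIsotopic_map _ _

/-- The curve of the moved knot. [folklore] -/
theorem curve_movedKnot (t : ℝ) : Knot.curve Fr.movedKnot t = ((stageOne D.Ψ (Fr.baseKnot (circlePt t)) : 𝕊 3) : 𝔼 4) := by
  rw [Knot.curve_apply, movedKnot, SphereEmbedding.map_apply]

/-- The window lies in the fundamental domain. [folklore] -/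
theorem window_subset_Ico : Icc Fr.w₁ Fr.w₂ ⊆ Ico Fr.a (Fr.a + 1) := fun s hs ↦
  ⟨by linarith [hs.1, Fr.le_w₁, Fr.ε₀_pos], by linarith [hs.2, Fr.w₂_le, Fr.ε₀_pos]⟩

/-- **The chart curve** `Y s = ψ (base knot (circlePt s))`. [folklore] -/
def Y (s : ℝ) : 𝔼 3 := psiN (Fr.baseKnot (circlePt s))

/-- **Window points in the chart**: either on the segment with clock in `[ρ₁, ρ₂]` or within `R₀`
of `o`; and the knot point is `ψ⁻¹ (Y s)`. [folklore] -/
theorem window_cases {s : ℝ} (hs : s ∈ Icc Fr.w₁ Fr.w₂) :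
    ((∃ ρ ∈ Icc ρ₁ ρ₂, Fr.Y s = D.o + ρ • D.d) ∨ Fr.Y s ∈ closedBall D.o R₀) ∧ Fr.baseKnot (circlePt s) = psiN.symm (Fr.Y s) := by
  have hco := Fr.coe_baseKnot_circlePt (Fr.window_subset_Ico hs)
  have key : ∀ {y : 𝔼 3}, Fr.I₀ s = ((psiN.symm y : 𝕊 3) : 𝔼 4) → Fr.Y s = y ∧ Fr.baseKnot (circlePt s) = psiN.symm (Fr.Y s) :=
    fun {y} he ↦ by
    have h1 : Fr.baseKnot (circlePt s) = psiN.symm y := Subtype.ext (hco.trans he)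
    have h2 : Fr.Y s = y := by rw [Y, h1, psiN_apply_psiN_symm]
    exact ⟨h2, by rw [h2]; exact h1⟩
  rcases Fr.inner s hs with ⟨ρ, hρ, he⟩ | ⟨y, hy, he⟩
  · exact ⟨Or.inl ⟨ρ, hρ, (key he).1⟩, (key he).2⟩
  · exact ⟨Or.inr (by rw [(key he).1]; exact hy), (key he).2⟩

/-- **Collar points in the chart**: on the segment with clock in `[ρ₁, ρ₂]`. [folklore] -/
theorem collar_cases {s : ℝ} (hs : s ∈ Icc Fr.w₁ Fr.c₁ ∪ Icc Fr.c₂ Fr.w₂) :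
    (∃ ρ ∈ Icc ρ₁ ρ₂, Fr.Y s = D.o + ρ • D.d) ∧ Fr.baseKnot (circlePt s) = psiN.symm (Fr.Y s) := by
  have hsW : s ∈ Icc Fr.w₁ Fr.w₂ := by
    rcases hs with h | h
    · exact ⟨h.1, by linarith [h.2, Fr.c₁_lt, Fr.c₂_lt]⟩
    · exact ⟨by linarith [h.1, Fr.w₁_lt, Fr.c₁_lt], h.2⟩
  have hco := Fr.coe_baseKnot_circlePt (Fr.window_subset_Ico hsW)
  obtain ⟨ρ, hρ, he⟩ := Fr.collar s hs
  have h1 : Fr.baseKnot (circlePt s) = psiN.symm (D.o + ρ • D.d) := Subtype.ext (hco.trans he)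
  have h2 : Fr.Y s = D.o + ρ • D.d := by rw [Y, h1, psiN_apply_psiN_symm]
  exact ⟨⟨ρ, hρ, h2⟩, by rw [h2]; exact h1⟩

variable (hS : D.Small ρ₁ ρ₂ R₀ R₁ rc)
include hS

/-- Window points lie in the near-identity ball. [folklore] -/
theorem Y_mem_ball {s : ℝ} (hs : s ∈ Icc Fr.w₁ Fr.w₂) : Fr.Y s ∈ closedBall D.o rc := by
  rcases (Fr.window_cases hs).1 with ⟨ρ, hρ, he⟩ | hy
  · rw [mem_closedBall, dist_eq_norm, he, add_sub_cancel_left]; exact hS.seg_ball ρ hρ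
  · exact closedBall_subset_closedBall (by linarith [hS.R₀_le, hS.R₀_pos]) hy

/-- Window points are good. [folklore] -/
theorem Y_mem_U {s : ℝ} (hs : s ∈ Icc Fr.w₁ Fr.w₂) : Fr.Y s ∈ D.U := hS.ball_subset (Fr.Y_mem_ball hS hs)

omit hS in
/-- The clock range lies in the segment range. [folklore] -/
theorem Icc_subset_of_small (hS : D.Small ρ₁ ρ₂ R₀ R₁ rc) : Icc ρ₁ ρ₂ ⊆ Icc D.ρlo D.ρhi :=
  Icc_subset_Icc hS.ρ₁_le hS.ρ₂_le

/-! ### The chart curve: smoothness and regularity -/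

omit hS in
/-- The chart curve is `C^∞` at parameters whose knot point is not the north pole. [folklore] -/
theorem contDiffAt_Y {s : ℝ} (hne : Fr.baseKnot (circlePt s) ≠ northPole) : ContDiffAt ℝ ∞ Fr.Y s := by
  have h1 : ContMDiffAt 𝓘(ℝ, ℝ) (𝓡 3) ∞ (fun s ↦ Fr.baseKnot (circlePt s)) s :=
    (Fr.baseKnot.contMDiff.comp contMDiff_circlePt) s
  have h2 : ContMDiffAt (𝓡 3) 𝓘(ℝ, 𝔼 3) ∞ psiN (Fr.baseKnot (circlePt s)) := isFullChart_psiN.contMDiffAt (mem_psiN_source hne)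
  exact contMDiffAt_iff_contDiffAt.1 (h2.comp s h1)

omit hS in
/-- On the window the knot point is not the north pole. [folklore] -/
theorem baseKnot_ne_northPole {s : ℝ} (hs : s ∈ Icc Fr.w₁ Fr.w₂) : Fr.baseKnot (circlePt s) ≠ northPole := by
  rw [(Fr.window_cases hs).2]; exact psiN_symm_ne_northPole _

omit hS in
/-- **The chart curve is regular on the window**: it is differentiable there with nonzero
derivative (the piece function factors through it near every window parameter). [folklore] -/
theorem hasDerivAt_Y {s : ℝ} (hs : s ∈ Icc Fr.w₁ Fr.w₂) : HasDerivAt Fr.Y (deriv Fr.Y s) s ∧ deriv Fr.Y s ≠ 0 := by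
  have hne := Fr.baseKnot_ne_northPole hs
  have hY : HasDerivAt Fr.Y (deriv Fr.Y s) s := ((Fr.contDiffAt_Y hne).differentiableAt (by simp)).hasDerivAt
  refine ⟨hY, fun h0 ↦ ?_⟩
  -- near `s`, `I₀ = (coe ∘ ψ⁻¹) ∘ Y`
  have hsI : s ∈ Ioo Fr.a (Fr.a + 1) := ⟨by linarith [hs.1, Fr.le_w₁, Fr.ε₀_pos], by linarith [hs.2, Fr.w₂_le, Fr.ε₀_pos]⟩
  have hopen : IsOpen ({s' : ℝ | Fr.baseKnot (circlePt s') ≠ northPole} ∩ Ioo Fr.a (Fr.a + 1)) :=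
    (isOpen_ne.preimage (Fr.baseKnot.continuous.comp contMDiff_circlePt.continuous)).inter isOpen_Ioo
  have hev : Fr.I₀ =ᶠ[𝓝 s] fun s' ↦ ((psiN.symm (Fr.Y s') : 𝕊 3) : 𝔼 4) := by
    filter_upwards [hopen.mem_nhds ⟨hne, hsI⟩] with s' hs'
    rw [Y, psiN_symm_apply_psiN hs'.1, Fr.coe_baseKnot_circlePt (Ioo_subset_Ico_self hs'.2)]
  have hc := ((contDiff_coe_psiN_symm.differentiable (by simp)) (Fr.Y s)).hasFDerivAt.comp_hasDerivAt s hY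
  rw [h0, map_zero] at hc
  have hd : deriv Fr.I₀ s = 0 := by rw [hev.deriv_eq]; exact hc.deriv
  exact Fr.isRegularLoop.deriv_ne_zero_of_mem Fr.ε₀_pos Fr.seam (Ioo_subset_Ico_self hsI) hd

/-! ### The family of modifications -/

/-- **The inserted pieces**: `ψ⁻¹ (A (P_{1-u} (Y s)))`. [folklore] -/
def ins (u s : ℝ) : 𝔼 4 :=
  ((psiN.symm (D.A (lineStage D.P (1 - u) (Fr.Y s))) : 𝕊 3) : 𝔼 4)

/-- **The family**: the inserted pieces on the open window, the moved knot elsewhere. [folklore] -/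
def fam (u s : ℝ) : 𝔼 4 := by
  classical exact if s ∈ Ioo Fr.w₁ Fr.w₂ then Fr.ins u s else Knot.curve Fr.movedKnot s

omit hS in
/-- On the open window the family is the inserted piece. [folklore] -/
theorem fam_of_mem (u : ℝ) {s : ℝ} (hs : s ∈ Ioo Fr.w₁ Fr.w₂) : Fr.fam u s = Fr.ins u s := by
  simp only [fam]; rw [if_pos hs]

omit hS in
/-- Off the open window the family is the moved knot. [folklore] -/
theorem fam_of_not_mem (u : ℝ) {s : ℝ} (hs : s ∉ Ioo Fr.w₁ Fr.w₂) : Fr.fam u s = Knot.curve Fr.movedKnot s := by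
  simp only [fam]; rw [if_neg hs]

/-- **Collar agreement**: on the collars every inserted piece is the moved knot (`P = id` on the
segment, `A (o + ρ d) = o' + ρ d'`, and the segment hypothesis). [folklore] -/
theorem ins_eq_curve_of_collar (u : ℝ) {s : ℝ} (hs : s ∈ Icc Fr.w₁ Fr.c₁ ∪ Icc Fr.c₂ Fr.w₂) :
    Fr.ins u s = Knot.curve Fr.movedKnot s := by
  obtain ⟨⟨ρ, hρ, hY⟩, hK⟩ := Fr.collar_cases hs
  have hρ' : ρ ∈ Icc D.ρlo D.ρhi := Icc_subset_of_small hS hρ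
  rw [ins, hY, lineStage_of_eq (D.P_seg hρ'), D.A_seg, Fr.curve_movedKnot, hK, hY, D.seg ρ hρ']

/-- On the window the family is the inserted piece (also at the end points). [folklore] -/
theorem fam_eq_ins_of_mem_window (u : ℝ) {s : ℝ} (hs : s ∈ Icc Fr.w₁ Fr.w₂) : Fr.fam u s = Fr.ins u s := by
  by_cases h : s ∈ Ioo Fr.w₁ Fr.w₂
  · exact Fr.fam_of_mem u h
  · rw [Fr.fam_of_not_mem u h]
    rw [mem_Ioo, not_and_or, not_lt, not_lt] at h
    rcases h with h | h
    · exact (Fr.ins_eq_curve_of_collar hS u (Or.inl ⟨hs.1, by linarith [Fr.w₁_lt]⟩)).symm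
    · exact (Fr.ins_eq_curve_of_collar hS u (Or.inr ⟨by linarith [Fr.c₂_lt], hs.2⟩)).symm

/-- Left of `c₁` the family is the moved knot. [folklore] -/
theorem fam_eq_curve_of_lt (u : ℝ) {s : ℝ} (hs : s < Fr.c₁) : Fr.fam u s = Knot.curve Fr.movedKnot s := by
  by_cases h : s ∈ Ioo Fr.w₁ Fr.w₂
  · rw [Fr.fam_of_mem u h]; exact Fr.ins_eq_curve_of_collar hS u (Or.inl ⟨h.1.le, hs.le⟩)
  · exact Fr.fam_of_not_mem u h

/-- Right of `c₂` the family is the moved knot. [folklore] -/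
theorem fam_eq_curve_of_gt (u : ℝ) {s : ℝ} (hs : Fr.c₂ < s) : Fr.fam u s = Knot.curve Fr.movedKnot s := by
  by_cases h : s ∈ Ioo Fr.w₁ Fr.w₂
  · rw [Fr.fam_of_mem u h]; exact Fr.ins_eq_curve_of_collar hS u (Or.inr ⟨hs.le, h.2.le⟩)
  · exact Fr.fam_of_not_mem u h

/-- **At `u = 0` the family is the moved knot** (`A ∘ P = Φ`). [folklore] -/
theorem fam_zero (s : ℝ) : Fr.fam 0 s = Knot.curve Fr.movedKnot s := by
  by_cases h : s ∈ Ioo Fr.w₁ Fr.w₂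
  · have hs := Ioo_subset_Icc_self h
    have hU : stageOne D.Ψ (psiN.symm (Fr.Y s)) ≠ northPole := Fr.Y_mem_U hS hs
    rw [Fr.fam_of_mem 0 h, ins, sub_zero, lineStage_one, D.A_P, chartConj, psiN_symm_apply_psiN hU, Fr.curve_movedKnot,
      (Fr.window_cases hs).2]
  · exact Fr.fam_of_not_mem 0 h

/-- The inserted pieces are jointly `C^∞` at window parameters. [folklore] -/
theorem contDiffAt_ins {u s : ℝ} (hs : s ∈ Icc Fr.w₁ Fr.w₂) : ContDiffAt ℝ ∞ (uncurry Fr.ins) (u, s) := by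
  have hY : ContDiffAt ℝ ∞ (Fr.Y ∘ Prod.snd) (u, s) :=
    ContDiffAt.comp (g := Fr.Y) (f := Prod.snd) (u, s) (Fr.contDiffAt_Y (Fr.baseKnot_ne_northPole hs)) contDiffAt_snd
  have hP : ContDiffAt ℝ ∞ (D.P ∘ Fr.Y ∘ Prod.snd) (u, s) :=
    ContDiffAt.comp (g := D.P) (f := Fr.Y ∘ Prod.snd) (u, s) (D.contDiffAt_P (Fr.Y_mem_U hS hs)) hY
  have hτ : ContDiffAt ℝ ∞ (fun p : ℝ × ℝ ↦ (1 - p.1 : ℝ)) (u, s) := (contDiffAt_const.sub contDiffAt_fst)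
  have hQ : ContDiffAt ℝ ∞ (fun p : ℝ × ℝ ↦ lineStage D.P (1 - p.1) (Fr.Y p.2)) (u, s) := hY.add (hτ.smul (hP.sub hY))
  have hA : ContDiffAt ℝ ∞ (fun p : ℝ × ℝ ↦ D.A (lineStage D.P (1 - p.1) (Fr.Y p.2))) (u, s) := D.contDiff_A.contDiffAt.comp _ hQ
  exact contDiff_coe_psiN_symm.contDiffAt.comp (u, s) hA

/-- **The family is jointly `C^∞`.** [folklore] -/
theorem contDiff_fam : ContDiff ℝ ∞ (uncurry Fr.fam) := by
  rw [contDiff_iff_contDiffAt]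
  rintro ⟨u, s⟩
  by_cases h : s ∈ Ioo Fr.w₁ Fr.w₂
  · have hev : uncurry Fr.fam =ᶠ[𝓝 (u, s)] uncurry Fr.ins := by
      have hopen : IsOpen {p : ℝ × ℝ | p.2 ∈ Ioo Fr.w₁ Fr.w₂} := isOpen_Ioo.preimage continuous_snd
      filter_upwards [hopen.mem_nhds (show (u, s) ∈ {p : ℝ × ℝ | p.2 ∈ Ioo Fr.w₁ Fr.w₂} from h)] with p hp
      exact Fr.fam_of_mem p.1 hp
    exact (Fr.contDiffAt_ins hS (Ioo_subset_Icc_self h)).congr_of_eventuallyEq hev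
  · have hcurve : ContDiffAt ℝ ∞ (fun p : ℝ × ℝ ↦ Knot.curve Fr.movedKnot p.2) (u, s) :=
      (Fr.movedKnot.contDiff_curve.comp contDiff_snd).contDiffAt
    rw [mem_Ioo, not_and_or, not_lt, not_lt] at h
    rcases h with h | h
    · have hev : uncurry Fr.fam =ᶠ[𝓝 (u, s)] fun p : ℝ × ℝ ↦ Knot.curve Fr.movedKnot p.2 := by
        have hopen : IsOpen {p : ℝ × ℝ | p.2 < Fr.c₁} := isOpen_Iio.preimage continuous_snd
        filter_upwards [hopen.mem_nhds (show (u, s) ∈ {p : ℝ × ℝ | p.2 < Fr.c₁} by simp only [mem_setOf_eq]; linarith [Fr.w₁_lt])] with p hp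
        exact Fr.fam_eq_curve_of_lt hS p.1 hp
      exact hcurve.congr_of_eventuallyEq hev
    · have hev : uncurry Fr.fam =ᶠ[𝓝 (u, s)] fun p : ℝ × ℝ ↦ Knot.curve Fr.movedKnot p.2 := by
        have hopen : IsOpen {p : ℝ × ℝ | Fr.c₂ < p.2} := isOpen_Ioi.preimage continuous_snd
        filter_upwards [hopen.mem_nhds (show (u, s) ∈ {p : ℝ × ℝ | Fr.c₂ < p.2} by simp only [mem_setOf_eq]; linarith [Fr.c₂_lt])] with p hp
        exact Fr.fam_eq_curve_of_gt hS p.1 hp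
      exact hcurve.congr_of_eventuallyEq hev

/-- The family is a unit vector on the window. [folklore] -/
theorem norm_fam (u : ℝ) {s : ℝ} (hs : s ∈ Icc Fr.w₁ Fr.w₂) : ‖Fr.fam u s‖ = 1 := by
  rw [Fr.fam_eq_ins_of_mem_window hS u hs, ins]; exact norm_eq_of_mem_sphere _

/-- **The stage map of the window point**: for `u ∈ [0, 1]` and `s` in the window, `P_{1-u} (Y s)`
lies within `(3/2) ‖Y s - o‖` of `o`, in the near-identity ball. [folklore] -/
theorem norm_lineStage_Y_le {u : ℝ} (hu : u ∈ Icc (0 : ℝ) 1) {s : ℝ} (hs : s ∈ Icc Fr.w₁ Fr.w₂) :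
    ‖lineStage D.P (1 - u) (Fr.Y s) - D.o‖ ≤ 3 / 2 * ‖Fr.Y s - D.o‖ :=
  norm_lineStage_sub_le D.isOpen_U hS.ball_subset D.contDiffOn_P hS.fderiv_le hS.rc_pos.le D.P_o
    ⟨by linarith [hu.2], by linarith [hu.1]⟩ (Fr.Y_mem_ball hS hs)

/-- **The family is regular on the window** (`u ∈ [0, 1]`). [folklore] -/
theorem deriv_fam_ne_zero {u : ℝ} (hu : u ∈ Icc (0 : ℝ) 1) {s : ℝ} (hs : s ∈ Icc Fr.w₁ Fr.w₂) : deriv (Fr.fam u) s ≠ 0 := by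
  have hτ : (1 - u) ∈ Icc (0 : ℝ) 1 := ⟨by linarith [hu.2], by linarith [hu.1]⟩
  by_cases h1 : s < Fr.c₁
  · have hev : Fr.fam u =ᶠ[𝓝 s] Knot.curve Fr.movedKnot := by
      filter_upwards [Iio_mem_nhds h1] with s' hs' using Fr.fam_eq_curve_of_lt hS u hs'
    rw [hev.deriv_eq]; exact Fr.movedKnot.deriv_curve_ne_zero s
  by_cases h2 : Fr.c₂ < s
  · have hev : Fr.fam u =ᶠ[𝓝 s] Knot.curve Fr.movedKnot := by
      filter_upwards [Ioi_mem_nhds h2] with s' hs' using Fr.fam_eq_curve_of_gt hS u hs'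
    rw [hev.deriv_eq]; exact Fr.movedKnot.deriv_curve_ne_zero s
  push Not at h1 h2
  have hIoo : s ∈ Ioo Fr.w₁ Fr.w₂ := ⟨by linarith [Fr.w₁_lt], by linarith [Fr.c₂_lt]⟩
  have hev : Fr.fam u =ᶠ[𝓝 s] Fr.ins u := by
    filter_upwards [Ioo_mem_nhds hIoo.1 hIoo.2] with s' hs' using Fr.fam_of_mem u hs'
  rw [hev.deriv_eq]
  obtain ⟨hY, hY0⟩ := Fr.hasDerivAt_Y hs
  have hyb := Fr.Y_mem_ball hS hs
  have hPz : HasFDerivAt D.P (fderiv ℝ D.P (Fr.Y s)) (Fr.Y s) := ((D.contDiffAt_P (Fr.Y_mem_U hS hs)).differentiableAt (by simp)).hasFDerivAt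
  have hQ := hasFDerivAt_lineStage (t := 1 - u) hPz
  have hinjQ : Injective (fderiv ℝ (lineStage D.P (1 - u)) (Fr.Y s)) :=
    injective_fderiv_lineStage D.isOpen_U hS.ball_subset D.contDiffOn_P hS.fderiv_le hτ hyb
  rw [hQ.fderiv] at hinjQ
  have hc : HasDerivAt (fun s ↦ D.A (lineStage D.P (1 - u) (Fr.Y s)))
      (((D.L : (𝔼 3) ≃L[ℝ] 𝔼 3) : (𝔼 3) →L[ℝ] 𝔼 3)
        ((ContinuousLinearMap.id ℝ (𝔼 3) + (1 - u) • (fderiv ℝ D.P (Fr.Y s) - ContinuousLinearMap.id ℝ (𝔼 3))) (deriv Fr.Y s))) s :=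
    (D.hasFDerivAt_A _).comp_hasDerivAt s (hQ.comp_hasDerivAt s hY)
  have hne : ((D.L : (𝔼 3) ≃L[ℝ] 𝔼 3) : (𝔼 3) →L[ℝ] 𝔼 3)
      ((ContinuousLinearMap.id ℝ (𝔼 3) + (1 - u) • (fderiv ℝ D.P (Fr.Y s) - ContinuousLinearMap.id ℝ (𝔼 3))) (deriv Fr.Y s)) ≠ 0 := by
    rw [ContinuousLinearEquiv.coe_coe]
    exact D.L.map_ne_zero_iff.2 fun h0 ↦ hY0 (hinjQ (by rw [h0, map_zero]))
  exact deriv_coe_psiN_symm_comp_ne_zero hc hne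

/-- **The family is injective on the window** (`u ∈ [0, 1]`): `A` is injective, the stage map is
injective on the near-identity ball, and `I₀` factors through the chart curve. [folklore] -/
theorem injOn_fam {u : ℝ} (hu : u ∈ Icc (0 : ℝ) 1) : InjOn (Fr.fam u) (Icc Fr.w₁ Fr.w₂) := by
  intro s hs s' hs' he
  have hτ : (1 - u) ∈ Icc (0 : ℝ) 1 := ⟨by linarith [hu.2], by linarith [hu.1]⟩
  rw [Fr.fam_eq_ins_of_mem_window hS u hs, Fr.fam_eq_ins_of_mem_window hS u hs', ins, ins] at he
  have h1 := D.A_injective (coe_psiN_symm_injective he)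
  have h2 : Fr.Y s = Fr.Y s' :=
    injOn_lineStage D.isOpen_U hS.ball_subset D.contDiffOn_P hS.fderiv_le hτ (Fr.Y_mem_ball hS hs) (Fr.Y_mem_ball hS hs') h1
  have h3 : Fr.I₀ s = Fr.I₀ s' := by
    rw [← Fr.coe_baseKnot_circlePt (Fr.window_subset_Ico hs), ← Fr.coe_baseKnot_circlePt (Fr.window_subset_Ico hs'),
      (Fr.window_cases hs).2, (Fr.window_cases hs').2, h2]
  exact Fr.injOn (Fr.window_subset_Ico hs) (Fr.window_subset_Ico hs') h3

/-- **The inserted pieces in the chart**: for a window parameter `s` and `u ∈ [0, 1]` the chart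
value `A (P_{1-u} (Y s))` is `o' + ρ d'` with `ρ ∈ [ρ₁, ρ₂]` (segment type) or lies within
`‖L‖ (3/2) R₀` of `o'` (unit type). [folklore] -/
theorem ins_cases {u : ℝ} (hu : u ∈ Icc (0 : ℝ) 1) {s : ℝ} (hs : s ∈ Icc Fr.w₁ Fr.w₂) :
    (∃ ρ ∈ Icc ρ₁ ρ₂, D.A (lineStage D.P (1 - u) (Fr.Y s)) = D.o' + ρ • D.d') ∨
      ‖D.A (lineStage D.P (1 - u) (Fr.Y s)) - D.o'‖ ≤ ‖((D.L : (𝔼 3) ≃L[ℝ] 𝔼 3) : (𝔼 3) →L[ℝ] 𝔼 3)‖ * (3 / 2 * R₀) := by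
  rcases (Fr.window_cases hs).1 with ⟨ρ, hρ, hY⟩ | hy
  · left
    refine ⟨ρ, hρ, ?_⟩
    rw [hY, lineStage_of_eq (D.P_seg (Icc_subset_of_small hS hρ)), D.A_seg]
  · right
    have h1 := Fr.norm_lineStage_Y_le hS hu hs
    rw [mem_closedBall, dist_eq_norm] at hy
    refine (D.norm_A_sub_le _).trans ?_
    exact mul_le_mul_of_nonneg_left (by linarith) (norm_nonneg _)

/-- **The family avoids the moved knot off the window** (`u ∈ [0, 1]`). [folklore] -/
theorem fam_ne_curve {u : ℝ} (hu : u ∈ Icc (0 : ℝ) 1) {s : ℝ} (hs : s ∈ Icc Fr.w₁ Fr.w₂) {t : ℝ} (ht : t ∈ Ico Fr.a (Fr.a + 1))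
    (hts : t ∉ Icc Fr.w₁ Fr.w₂) : Fr.fam u s ≠ Knot.curve Fr.movedKnot t := by
  have hd' : 0 < ‖D.d'‖ := norm_pos_iff.2 D.d'_ne
  rw [Fr.fam_eq_ins_of_mem_window hS u hs, ins, Fr.curve_movedKnot]
  rcases Fr.off t ht hts with ⟨ρ, hρ, hρn, he⟩ | ⟨x, he, hx⟩
  · -- a segment point of the old host with clock outside the window range
    have hK : Fr.baseKnot (circlePt t) = psiN.symm (D.o + ρ • D.d) := Subtype.ext ((Fr.coe_baseKnot_circlePt ht).trans he)
    rw [hK, D.seg ρ hρ]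
    intro heq
    have hZ : D.A (lineStage D.P (1 - u) (Fr.Y s)) = D.o' + ρ • D.d' := coe_psiN_symm_injective heq
    rcases Fr.ins_cases hS hu hs with ⟨ρ', hρ', hZ'⟩ | hZ'
    · have : ρ' = ρ := smul_left_injective ℝ D.d'_ne (add_left_cancel (hZ'.symm.trans hZ))
      exact hρn (this ▸ hρ')
    · rw [hZ, add_sub_cancel_left, norm_smul, Real.norm_eq_abs] at hZ'
      have habs : min (-ρ₁) ρ₂ ≤ |ρ| := by
        rw [mem_Icc, not_and_or, not_le, not_le] at hρn
        rcases hρn with h | h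
        · rw [abs_of_neg (by linarith [hS.ρ₁_neg])]; exact (min_le_left _ _).trans (by linarith)
        · rw [abs_of_pos (by linarith [hS.ρ₂_pos])]; exact (min_le_right _ _).trans h.le
      have := hS.unit_seg
      nlinarith
  · -- a point carried far from `o'` (or to the north pole)
    have hK : Fr.baseKnot (circlePt t) = x := Subtype.ext ((Fr.coe_baseKnot_circlePt ht).trans he)
    rw [hK]
    intro heq
    have hx1 : psiN.symm (D.A (lineStage D.P (1 - u) (Fr.Y s))) = stageOne D.Ψ x := Subtype.ext heq
    rcases hx with hN | hfar
    · rw [hN] at hx1; exact psiN_symm_ne_northPole _ hx1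
    · rw [← hx1, psiN_apply_psiN_symm] at hfar
      rcases Fr.ins_cases hS hu hs with ⟨ρ', hρ', hZ'⟩ | hZ'
      · have : D.A (lineStage D.P (1 - u) (Fr.Y s)) - D.o' = ρ' • D.d' := by rw [hZ']; abel
        rw [this] at hfar
        linarith [hS.seg_far ρ' hρ']
      · linarith [hS.unit_far]

/-- **The family of modifications of the moved knot.** [folklore] -/
theorem isModification : Fr.movedKnot.IsModification Fr.a Fr.ε₀ Fr.fam (Icc Fr.w₁ Fr.w₂) where
  ε_pos := Fr.ε₀_pos
  contDiff := Fr.contDiff_fam hS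
  subset := Icc_subset_Icc Fr.le_w₁ Fr.w₂_le
  isClosed := isClosed_Icc
  eq_curve u _ ht := Fr.fam_of_not_mem u (fun h ↦ ht (Ioo_subset_Icc_self h))
  zero_eq := Fr.fam_zero hS
  norm_eq_one u _ _ hs := Fr.norm_fam hS u hs
  deriv_ne_zero _ hu _ hs := Fr.deriv_fam_ne_zero hS hu hs
  injOn _ hu := Fr.injOn_fam hS hu
  disjoint _ hu _ hs _ ht hts := Fr.fam_ne_curve hS hu hs ht hts

/-- **The output knot**: the moved knot with the unit re-inserted at `o'` by `L`. [folklore] -/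
def outKnot : Knot := (Fr.isModification hS).knotAt 1

/-- **THE SEGMENT CONJUGATION LEMMA.** The base knot of a loop frame (smallness granted) is isotopic
to the output knot. [cite: HirschDT1976, Ch. 8 §1, Thm. 1.3] -/
theorem isIsotopic_baseKnot_outKnot : Fr.baseKnot.IsIsotopic (Fr.outKnot hS) := by
  obtain ⟨Θ, -, hΘ, -⟩ := (Fr.isModification hS).exists_ambientIsotopy isOpen_univ (fun y hy ↦ absurd (mem_univ y) hy)
  have h1 : Fr.movedKnot.IsIsotopic (Fr.outKnot hS) := ⟨Θ, hΘ 1 ⟨zero_le_one, le_rfl⟩⟩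
  exact IsAmbientIsotopic.trans_holds (Fr.isIsotopic_baseKnot_movedKnot) h1

/-- **The output knot off the window** is the moved knot: `Ψ₁ (base knot)`. [folklore] -/
theorem outKnot_circlePt_of_not_mem {t : ℝ} (ht : t ∈ Ico Fr.a (Fr.a + 1)) (hts : t ∉ Icc Fr.w₁ Fr.w₂) :
    Fr.outKnot hS (circlePt t) = stageOne D.Ψ (Fr.baseKnot (circlePt t)) := by
  rw [outKnot, (Fr.isModification hS).knotAt_apply_of_forall_not_mem 1 (fun s hs he ↦ ?_), movedKnot, SphereEmbedding.map_apply]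
  obtain ⟨m, hm⟩ := circlePt_eq_circlePt_iff.1 he
  have hsI := Fr.window_subset_Ico hs
  have h1 : (m : ℝ) < 1 := by linarith [hsI.2, ht.1]
  have h2 : (-1 : ℝ) < m := by linarith [hsI.1, ht.2]
  have h1' : m < 1 := by exact_mod_cast h1
  have h2' : -1 < m := by exact_mod_cast h2
  obtain rfl : m = 0 := by omega
  simp only [Int.cast_zero, add_zero] at hm
  exact hts (hm ▸ hs)

/-- **The output knot on the window** is `ψ⁻¹ (A (Y s)) = ψ⁻¹ (o' + L (Y s - o))`. [folklore] -/
theorem coe_outKnot_circlePt_of_mem {s : ℝ} (hs : s ∈ Icc Fr.w₁ Fr.w₂) :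
    ((Fr.outKnot hS (circlePt s) : 𝕊 3) : 𝔼 4) = ((psiN.symm (D.A (Fr.Y s)) : 𝕊 3) : 𝔼 4) := by
  rw [outKnot, (Fr.isModification hS).coe_knotAt_circlePt_of_mem 1 hs, Real.smoothTransition.one,
    Fr.fam_eq_ins_of_mem_window hS 1 hs, ins, sub_self, lineStage_zero]

end Frame

end SegData

end SegmentConj

end Literature.Topology.FourManifolds
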